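import Literature.Topology.FourManifolds.BlowDownModelSphere
import Literature.Topology.FourManifolds.PalaisBallComplement
import Literature.Topology.FourManifolds.KnotsProofs
import HarnessLib

/-!
# A global flattening chart for the unknot, through the stereographic projection

Infrastructure (theorems only) for the connected-sum decomposition of surgery on a split link
(`Literature.Topology.FourManifolds.exists_isSurgery_zeroFramedUnlink`, `KirbyCalculus.lean`).
The standard unknot `unknot : 𝕊 1 ↪ 𝕊 3`, `u ↦ (u₀, u₁, 0, 0)`, is the image of the flat circle
`{z = 0, x² + y² = 4}` of radius `2` under Mathlib's inverse stereographic projection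
`σ_N⁻¹ = (stereographic' 3 N).symm` from the north pole `N = (0, 0, 0, 1)`, once the arbitrary
isometry `ℝ³ ≃ Nᗮ` built into `stereographic'` is undone by a linear isometry `S₀` of `ℝ³`.
Consequently `y ↦ R_N (σ_N⁻¹ (S₀ (2 y)))` (`R_N` the reflection of `𝕊 3` in `Nᗮ`, which fixes
the unknot pointwise) is a **flattening chart of the unknot defined on all of `ℝ³`**
(`Knot.FlatChart`, `BlowDownModelSphere.lean`), so that the framing-`0` tubular neighbourhoods of
the flat model (`Knot.FlatChart.ModelData.nbhd`, `hasFraming_nbhd`) are available for the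
unknot in a form compatible with the stereographic model `X # Sⁿ ≅ X` of
`ConnectedSumSphereIdentity.lean` (whose round disc is `σ_N⁻¹ ∘ S₀` and whose chart of
`𝕊 3 ∖ {-N}` is `σ_N ∘ R_N`).

* `exists_flatChart_unknot` — the pole `N`, the isometry `S₀` and the chart, with its formula
  and the identity `σ_N⁻¹ (S₀ (2 • flatCircle u)) = unknot u`.

## References

* M. A. Kervaire, J. W. Milnor, *Groups of homotopy spheres: I*, Ann. of Math. 77 (1963), §2.
* R. C. Kirby, *The Topology of 4-Manifolds*, LNM 1374 (1989), Ch. I §2 (the unknot and its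
  framings).
-/

open scoped Manifold ContDiff Topology RealInnerProductSpace
open Set Function Metric Module

noncomputable section

namespace Literature.Topology.FourManifolds

/-- Local notation: `𝔼 n` is the model Euclidean space `EuclideanSpace ℝ (Fin n)`. -/
local notation "𝔼 " n:arg => EuclideanSpace ℝ (Fin n)

/-- Local notation: `𝕊 n` is the unit sphere in `EuclideanSpace ℝ (Fin (n + 1))`. -/
local notation "𝕊 " n:arg => (Metric.sphere (0 : EuclideanSpace ℝ (Fin (n + 1))) 1)

attribute [local instance] fact_finrank_euclideanSpace_two fact_finrank_euclideanSpace_four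

open BlowDownFlat

/-! ### Local diffeomorphisms: inverses of charts -/

section Charts

variable {E : Type*} [NormedAddCommGroup E] [NormedSpace ℝ E] {H : Type*} [TopologicalSpace H]
  {I : ModelWithCorners ℝ E H} {M : Type*} [TopologicalSpace M] [ChartedSpace H M]

/-- The inverse of a chart of the atlas of a `C^∞` manifold is a local diffeomorphism from the
model space at every point of its target (cf. `KuiperDevelopment.lean`, same statement in the
Riemannian corner of the tree, not imported here). [folklore] -/
theorem isLocalDiffeomorphAt_symm_of_mem_atlas_of_mem_target [IsManifold I ∞ M]
    {e : OpenPartialHomeomorph M H} (he : e ∈ atlas H M) {y : H} (hy : y ∈ e.target) :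
    IsLocalDiffeomorphAt I I ∞ e.symm y :=
  let Φ : PartialDiffeomorph I I H M ∞ :=
    { toPartialEquiv := e.symm.toPartialEquiv
      open_source := e.open_target
      open_target := e.open_source
      contMDiffOn_toFun := contMDiffOn_symm_of_mem_maximalAtlas (IsManifold.subset_maximalAtlas he)
      contMDiffOn_invFun := contMDiffOn_of_mem_maximalAtlas (IsManifold.subset_maximalAtlas he) }
  Φ.isLocalDiffeomorphAt _ _ _ hy

end Charts

/-! ### The north pole and its orthogonal complement -/

section Pole

/-- The inverse stereographic projection is a local diffeomorphism at every point. [folklore] -/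
theorem isLocalDiffeomorphAt_stereographic'_symm_sphereThree (v : 𝕊 3) (y : 𝔼 3) :
    IsLocalDiffeomorphAt 𝓘(ℝ, 𝔼 3) (𝓡 3) ∞ (stereographic' 3 v).symm y := by
  have he : stereographic' 3 v ∈ atlas (𝔼 3) (𝕊 3) := ⟨v, rfl⟩
  exact isLocalDiffeomorphAt_symm_of_mem_atlas_of_mem_target (I := 𝓡 3) he (by simp)

/-- The inverse stereographic projection is injective. [folklore] -/
theorem stereographic'_symm_injective_sphereThree (v : 𝕊 3) :
    Injective (stereographic' 3 v).symm := by
  rw [← Set.injOn_univ, ← stereographic'_target v]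
  exact (stereographic' 3 v).symm.injOn

/-- **A global flattening chart of the unknot.** There are a point `N` of `𝕊 3` (the north pole
`(0, 0, 0, 1)`), a linear isometry `S₀` of `ℝ³` and a flattening chart `Φ` of the standard unknot
`u ↦ (u₀, u₁, 0, 0)` (`Knot.FlatChart`) defined on all of `ℝ³`, with
`Φ.Γ y = R_N (σ_N⁻¹ (S₀ (2 • y)))` — `σ_N = stereographic' 3 N` Mathlib's stereographic
projection from `N`, `R_N` the reflection of the sphere in `Nᗮ` — and such that the round disc
`σ_N⁻¹ ∘ S₀` of the model `X # Sⁿ ≅ X` (`ConnectedSumSphereIdentity.lean`) carries the flat circle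
of radius `2` onto the unknot: `σ_N⁻¹ (S₀ (2 • flatCircle u)) = unknot u`. The isometry `S₀`
undoes the arbitrary identification `ℝ³ ≃ Nᗮ` built into `stereographic'`: it is chosen so that
the tangential part of `S₀ y` is `(y₀, y₁, y₂, 0)`; then `σ_N⁻¹` of a vector of norm `2` is half
its tangential part (Mathlib's normalisation `σᵥ⁻¹ x = (‖x‖² + 4)⁻¹ (4 w(x) + (‖x‖² − 4) v)`), and
`R_N` fixes `Nᗮ ⊇ unknot` pointwise. [folklore] -/
theorem exists_flatChart_unknot :
    ∃ (N : 𝕊 3) (S₀ : 𝔼 3 ≃ₗᵢ[ℝ] 𝔼 3) (Φ : (unknot).FlatChart),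
      (N : 𝔼 4) = EuclideanSpace.single 3 1 ∧ Φ.Ω = univ ∧
      (∀ y, Φ.Γ y = poleReflectionSphere (n := 3) N ((stereographic' 3 N).symm (S₀ ((2 : ℝ) • y)))) ∧
      (∀ u : 𝕊 1, (stereographic' 3 N).symm (S₀ ((2 : ℝ) • flatCircle u)) = unknot u) := by
  -- the pole
  set Nv : 𝔼 4 := EuclideanSpace.single 3 1 with hNv
  have hNv1 : ‖Nv‖ = 1 := by simp [hNv]
  set N : 𝕊 3 := ⟨Nv, mem_sphere_zero_iff_norm.2 hNv1⟩ with hN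
  have hN0 : (N : 𝔼 4) ≠ 0 := ne_zero_of_mem_unit_sphere N
  -- the orthonormal basis `e₀, e₁, e₂` of `Nᗮ`
  set f : Fin 3 → 𝔼 4 := fun i ↦ EuclideanSpace.single (Fin.castSucc i) 1 with hf
  have hcast : ∀ i : Fin 3, (Fin.castSucc i : Fin 4) ≠ 3 := fun i ↦ by
    fin_cases i <;> decide
  have hfmem : ∀ i, f i ∈ (ℝ ∙ (N : 𝔼 4))ᗮ := fun i ↦ by
    rw [Submodule.mem_orthogonal_singleton_iff_inner_right]
    change ⟪Nv, EuclideanSpace.single (Fin.castSucc i) (1 : ℝ)⟫ = 0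
    rw [hNv, EuclideanSpace.inner_single_left]
    simp [(hcast i).symm]
  set f' : Fin 3 → (ℝ ∙ (N : 𝔼 4))ᗮ := fun i ↦ ⟨f i, hfmem i⟩ with hf'
  have hon : Orthonormal ℝ f' := by
    rw [orthonormal_iff_ite]
    intro i j
    change ⟪f i, f j⟫ = _
    rw [hf]
    simp only [EuclideanSpace.inner_single_left, map_one, one_mul]
    by_cases hij : i = j
    · subst hij; simp
    · simp [hij]
  have hdim : finrank ℝ (ℝ ∙ (N : 𝔼 4))ᗮ = 3 := Submodule.finrank_orthogonal_span_singleton hN0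
  have hsp : ⊤ ≤ Submodule.span ℝ (Set.range f') :=
    (hon.linearIndependent.span_eq_top_of_card_eq_finrank (by rw [hdim]; simp)).ge
  set ob : OrthonormalBasis (Fin 3) ℝ (ℝ ∙ (N : 𝔼 4))ᗮ := OrthonormalBasis.mk hon hsp with hob
  have hob_apply : ∀ i, (ob i : 𝔼 4) = f i := fun i ↦ by
    rw [hob, OrthonormalBasis.coe_mk]
  -- the isometry undoing Mathlib's identification `ℝ³ ≃ Nᗮ`
  set B : OrthonormalBasis (Fin 3) ℝ (ℝ ∙ (N : 𝔼 4))ᗮ :=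
    OrthonormalBasis.fromOrthogonalSpanSingleton 3 hN0 with hB
  set S₀ : 𝔼 3 ≃ₗᵢ[ℝ] 𝔼 3 := ob.repr.symm.trans B.repr with hS₀
  have htan : ∀ y : 𝔼 3, stereoTangential N (S₀ y) = ∑ i, y i • f i := fun y ↦ by
    change ((B.repr.symm (B.repr (ob.repr.symm y)) : (ℝ ∙ (N : 𝔼 4))ᗮ) : 𝔼 4) = _
    rw [LinearIsometryEquiv.symm_apply_apply, ← OrthonormalBasis.sum_repr_symm]
    rw [Submodule.coe_sum]
    refine Finset.sum_congr rfl fun i _ ↦ ?_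
    rw [Submodule.coe_smul, hob_apply]
  -- the identity `σ_N⁻¹ (S₀ (2 • flatCircle u)) = unknot u`
  have hnfc : ∀ u : 𝕊 1, ‖flatCircle u‖ = 1 := fun u ↦ by
    have h := norm_sq_eq_three (flatCircle u)
    have h0 : flatCircle u 0 = (u : 𝔼 2) 0 := rfl
    have h1 : flatCircle u 1 = (u : 𝔼 2) 1 := rfl
    have h2 : flatCircle u 2 = 0 := rfl
    rw [h0, h1, h2, sphere_sq u] at h
    nlinarith [norm_nonneg (flatCircle u)]
  have hmemU : ∀ u : 𝕊 1, ((unknot u : 𝕊 3) : 𝔼 4) ∈ (ℝ ∙ (N : 𝔼 4))ᗮ := fun u ↦ by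
    rw [Submodule.mem_orthogonal_singleton_iff_inner_right]
    change ⟪Nv, ((unknot u : 𝕊 3) : 𝔼 4)⟫ = 0
    rw [hNv, EuclideanSpace.inner_single_left]
    simp [unknot, SphereEmbedding.coe_standard, coe_sphereInclusion, euclideanInclusion_apply]
  have hkey : ∀ u : 𝕊 1, ∑ i : Fin 3, (flatCircle u) i • f i = ((unknot u : 𝕊 3) : 𝔼 4) := by
    intro u
    ext k
    have h0 : flatCircle u 0 = (u : 𝔼 2) 0 := rfl
    have h1 : flatCircle u 1 = (u : 𝔼 2) 1 := rfl
    have h2 : flatCircle u 2 = 0 := rfl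
    simp only [hf, Fin.sum_univ_three, h0, h1, h2, zero_smul, add_zero, PiLp.add_apply,
      PiLp.smul_apply, smul_eq_mul, unknot, SphereEmbedding.coe_standard, coe_sphereInclusion,
      euclideanInclusion_apply]
    fin_cases k <;> simp
  have hcircle : ∀ u : 𝕊 1, (stereographic' 3 N).symm (S₀ ((2 : ℝ) • flatCircle u)) = unknot u := by
    intro u
    apply Subtype.ext
    have hnorm : ‖S₀ ((2 : ℝ) • flatCircle u)‖ = 2 := by
      rw [LinearIsometryEquiv.norm_map, norm_smul, Real.norm_eq_abs, abs_of_pos two_pos, hnfc,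
        mul_one]
    have hsum : ∑ i : Fin 3, (((2 : ℝ) • flatCircle u) i) • f i =
        (2 : ℝ) • ∑ i : Fin 3, (flatCircle u) i • f i := by
      rw [Finset.smul_sum]
      refine Finset.sum_congr rfl fun i _ ↦ ?_
      rw [PiLp.smul_apply, smul_eq_mul, smul_smul]
    rw [coe_stereographic'_symm_apply, hnorm, htan, hsum, hkey, smul_smul]
    norm_num
  -- the chart
  set RN := poleReflectionSphere (n := 3) N with hRN
  have hRfix : ∀ u : 𝕊 1, RN (unknot u) = unknot u := fun u ↦
    Subtype.ext (by
      rw [hRN, LinearIsometryEquiv.coe_sphereDiffeomorph_apply]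
      exact Submodule.reflection_mem_subspace_eq_self (hmemU u))
  set twice : 𝔼 3 → 𝔼 3 := fun y ↦ (2 : ℝ) • y with htwice
  have htwice_diff : IsLocalDiffeomorph 𝓘(ℝ, 𝔼 3) 𝓘(ℝ, 𝔼 3) ∞ twice := by
    set L : 𝔼 3 ≃L[ℝ] 𝔼 3 := ContinuousLinearEquiv.equivOfInverse
      ((2 : ℝ) • ContinuousLinearMap.id ℝ (𝔼 3)) ((2⁻¹ : ℝ) • ContinuousLinearMap.id ℝ (𝔼 3))
      (fun y ↦ by simp [smul_smul]) (fun y ↦ by simp [smul_smul]) with hL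
    have : twice = L := by funext y; rfl
    rw [this]
    exact L.toDiffeomorph.isLocalDiffeomorph
  set Γ : 𝔼 3 → 𝕊 3 := fun y ↦ RN ((stereographic' 3 N).symm (S₀ (twice y))) with hΓ
  have hΓloc : ∀ y, IsLocalDiffeomorphAt 𝓘(ℝ, 𝔼 3) (𝓡 3) ∞ Γ y := fun y ↦ by
    have h1 : IsLocalDiffeomorphAt 𝓘(ℝ, 𝔼 3) 𝓘(ℝ, 𝔼 3) ∞ (S₀ ∘ twice) y :=
      IsLocalDiffeomorphAt.comp (hf := htwice_diff y)
        (hg := S₀.toContinuousLinearEquiv.toDiffeomorph.isLocalDiffeomorph _)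
    have h2 : IsLocalDiffeomorphAt 𝓘(ℝ, 𝔼 3) (𝓡 3) ∞ ((stereographic' 3 N).symm ∘ (S₀ ∘ twice)) y :=
      IsLocalDiffeomorphAt.comp (hf := h1)
        (hg := isLocalDiffeomorphAt_stereographic'_symm_sphereThree N _)
    exact IsLocalDiffeomorphAt.comp (hf := h2) (hg := RN.isLocalDiffeomorph _)
  have hΓinj : Injective Γ := fun y y' h ↦ by
    have h1 := RN.injective h
    have h2 := stereographic'_symm_injective_sphereThree N h1
    have h3 := S₀.injective h2
    simpa [htwice] using h3
  refine ⟨N, S₀, ⟨univ, isOpen_univ, Γ, fun y _ ↦ hΓloc y, hΓinj.injOn, subset_univ _, fun u ↦ ?_⟩,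
    rfl, rfl, fun y ↦ rfl, hcircle⟩
  change RN ((stereographic' 3 N).symm (S₀ ((2 : ℝ) • flatCircle u))) = unknot u
  rw [hcircle, hRfix]

end Pole

end Literature.Topology.FourManifolds
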